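import Summits.RiemannHypothesis.RiemannHypothesis.Theorems.HandoffRouteEAssembly
import Summits.RiemannHypothesis.RiemannHypothesis.Theorems.PfPersistenceM2WindowSum

/-!
# Handoff (rh-explicit, prove-1), Route E: the mollifier family scales, so its strip-decay constant is explicit in `k`

The Literature mollifiers `φ_k = (bump k).normed` (radii `1/(2(k+1)) < 1/(k+1)`) have the fixed ratio
`rOut/rIn = 2`, hence are dilates of one another: `φ_k(x) = (k+1) φ_0((k+1)x)` (tree:
`PfPersistenceM2Leak.moll_eq_scaled`, reused here).  Consequently
`φ_k'' (x) = (k+1)³ φ_0''((k+1)x)` and the strip-decay constant of `norm_weilMellin_le`,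
`D_{φ_k} = ∫|φ_k| e^{|t|/2} + ∫|φ_k''| e^{|t|/2}`, grows at most quadratically:
`D_{φ_k} ≤ e^{1/2} (1 + D_{φ_0}) (k+1)²` (`weilDecayConst_moll_le`).  Plugged into the Route E assembly
(`weilGroundEnergy_le_of_summable_seed`) this makes the ground-energy bound explicit in the mollifier
index up to the single absolute constant `D_{φ_0}` (`weilGroundEnergy_le_of_summable_seed_explicit`):
the kernel form of the cell's paper Theorem E♭ (handoff/prove-1 ATTEMPT-11) now waits only on the seed
lemma (Kaiser–Bessel, paper Lemma KB′).  No hypothesis on the zeros; nothing here bears on RH.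
-/

set_option linter.dupNamespace false  -- the mandated namespace repeats `RiemannHypothesis`

noncomputable section

open Complex Filter Set Topology MeasureTheory
open scoped FourierTransform
open Literature.NumberTheory.LFunctions Literature.NumberTheory.LFunctions.WeilContinuous

namespace Summit.RiemannHypothesis.RiemannHypothesis.Theorems.HandoffRouteE

open Summit.RiemannHypothesis.RiemannHypothesis.Theorems

/-- First derivative under the scaling: `φ_k'(x) = (k+1)² φ_0'((k+1)x)`. -/
theorem deriv_moll_eq (k : ℕ) :
    deriv (moll k) = fun x => ((((k : ℝ) + 1) ^ 2 : ℝ) : ℂ) * deriv (moll 0) (((k : ℝ) + 1) * x) := by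
  set a : ℝ := (k : ℝ) + 1 with ha
  have hfun : moll k = fun x => ((a : ℝ) : ℂ) * (fun y => moll 0 y) (a * x) := by
    funext x; rw [ha]; exact PfPersistenceM2Leak.moll_eq_scaled k x
  funext x
  rw [hfun, deriv_const_mul_field, show (fun x => (fun y => moll 0 y) (a * x)) = ((fun y => moll 0 y) <| a * ·) from rfl,
    deriv_comp_mul_left a (fun y => moll 0 y) x, Complex.real_smul]
  push_cast
  ring

/-- Second derivative under the scaling: `φ_k''(x) = (k+1)³ φ_0''((k+1)x)`. -/
theorem deriv_deriv_moll_eq (k : ℕ) (x : ℝ) :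
    deriv (deriv (moll k)) x = ((((k : ℝ) + 1) ^ 3 : ℝ) : ℂ) * deriv (deriv (moll 0)) (((k : ℝ) + 1) * x) := by
  set a : ℝ := (k : ℝ) + 1 with ha
  rw [deriv_moll_eq k, ← ha]
  rw [show (fun x => (((a ^ 2 : ℝ)) : ℂ) * deriv (moll 0) (a * x)) =
      fun x => (((a ^ 2 : ℝ)) : ℂ) * ((deriv (moll 0)) <| a * ·) x from rfl,
    deriv_const_mul_field, deriv_comp_mul_left a (deriv (moll 0)) x, Complex.real_smul]
  push_cast
  ring

/-- `φ_k'' = 0` off `[-1, 1]`. -/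
theorem deriv_deriv_moll_eq_zero (k : ℕ) {t : ℝ} (ht : 1 < |t|) : deriv (deriv (moll k)) t = 0 := by
  have hopen : IsOpen {x : ℝ | 1 < |x|} := isOpen_lt continuous_const continuous_abs
  have h1 : moll k =ᶠ[𝓝 t] fun _ => (0 : ℂ) := by
    filter_upwards [hopen.mem_nhds ht] with x hx
    exact moll_eq_zero ((bump_rOut_le_one k).trans hx.le)
  have h3 := (h1.deriv).deriv
  rw [h3.eq_of_nhds]
  simp

/-- **Explicit growth of the mollifier's strip-decay constant**: `D_{φ_k} ≤ e^{1/2}(1 + D_{φ_0})(k+1)²`. -/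
theorem weilDecayConst_moll_le (k : ℕ) :
    weilDecayConst (moll k) ≤
      Real.exp (1 / 2) * (1 + weilDecayConst (moll 0)) * ((k : ℝ) + 1) ^ 2 := by
  set a : ℝ := (k : ℝ) + 1 with ha
  have ha1 : 1 ≤ a := by rw [ha]; linarith [(Nat.cast_nonneg k : (0 : ℝ) ≤ k)]
  have ha0 : 0 < a := by linarith
  have hD0 : 0 ≤ weilDecayConst (moll 0) := weilDecayConst_nonneg _
  have he : (1 : ℝ) ≤ Real.exp (1 / 2) := Real.one_le_exp (by norm_num)
  -- (i) the mass term
  have hL1 : weilL1 (moll k) ≤ Real.exp (1 / 2) := by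
    unfold weilL1
    have hle : ∀ t : ℝ, ‖moll k t‖ * Real.exp (|t| / 2) ≤ ‖moll k t‖ * Real.exp (1 / 2) := by
      intro t
      rcases le_or_gt |t| 1 with h | h
      · exact mul_le_mul_of_nonneg_left (Real.exp_le_exp.2 (by linarith)) (norm_nonneg _)
      · rw [moll_eq_zero ((bump_rOut_le_one k).trans h.le)]; simp
    calc ∫ t : ℝ, ‖moll k t‖ * Real.exp (|t| / 2)
        ≤ ∫ t : ℝ, ‖moll k t‖ * Real.exp (1 / 2) := by
          refine integral_mono_of_nonneg (Eventually.of_forall fun t => by positivity)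
            ((integrable_norm_moll k).mul_const _) (Eventually.of_forall hle)
      _ = Real.exp (1 / 2) := by rw [integral_mul_const, integral_norm_moll, one_mul]
  -- (ii) the second-derivative term
  have hk2 : IsWeilTest (deriv (deriv (moll 0))) := (isWeilTest_moll 0).deriv.deriv
  have hcont : Continuous (deriv (deriv (moll 0))) := hk2.1.continuous
  have hcs : HasCompactSupport (deriv (deriv (moll 0))) := hk2.2
  have hint0 : Integrable (fun t : ℝ => ‖deriv (deriv (moll 0)) t‖) volume :=
    (hcont.integrable_of_hasCompactSupport hcs).norm
  have hL1'' : weilL1 (deriv (deriv (moll k))) ≤ Real.exp (1 / 2) * a ^ 2 * weilDecayConst (moll 0) := by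
    unfold weilL1
    have hle : ∀ t : ℝ, ‖deriv (deriv (moll k)) t‖ * Real.exp (|t| / 2) ≤
        Real.exp (1 / 2) * (a ^ 3 * ‖deriv (deriv (moll 0)) (a * t)‖) := by
      intro t
      rcases le_or_gt |t| 1 with h | h
      · rw [deriv_deriv_moll_eq k t, ← ha, norm_mul, Complex.norm_real, Real.norm_of_nonneg (by positivity)]
        calc (a ^ 3 * ‖deriv (deriv (moll 0)) (a * t)‖) * Real.exp (|t| / 2)
            ≤ (a ^ 3 * ‖deriv (deriv (moll 0)) (a * t)‖) * Real.exp (1 / 2) :=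
              mul_le_mul_of_nonneg_left (Real.exp_le_exp.2 (by linarith)) (by positivity)
          _ = Real.exp (1 / 2) * (a ^ 3 * ‖deriv (deriv (moll 0)) (a * t)‖) := by ring
      · rw [deriv_deriv_moll_eq_zero k h]; simp; positivity
    have hint1 : Integrable (fun t : ℝ => a ^ 3 * ‖deriv (deriv (moll 0)) (a * t)‖) volume := by
      have := (hint0.comp_mul_left' ha0.ne')
      exact this.const_mul _
    have hkk : IsWeilTest (deriv (deriv (moll k))) := (isWeilTest_moll k).deriv.deriv
    calc ∫ t : ℝ, ‖deriv (deriv (moll k)) t‖ * Real.exp (|t| / 2)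
        ≤ ∫ t : ℝ, Real.exp (1 / 2) * (a ^ 3 * ‖deriv (deriv (moll 0)) (a * t)‖) := by
          refine integral_mono_of_nonneg (Eventually.of_forall fun t => by positivity)
            (hint1.const_mul _) (Eventually.of_forall hle)
      _ = Real.exp (1 / 2) * (a ^ 3 * (|a⁻¹| * ∫ t : ℝ, ‖deriv (deriv (moll 0)) t‖)) := by
          rw [integral_const_mul, integral_const_mul,
            Measure.integral_comp_mul_left (fun t => ‖deriv (deriv (moll 0)) t‖) a, smul_eq_mul]
      _ = Real.exp (1 / 2) * a ^ 2 * ∫ t : ℝ, ‖deriv (deriv (moll 0)) t‖ := by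
          rw [abs_of_pos (inv_pos.2 ha0)]; field_simp
      _ ≤ Real.exp (1 / 2) * a ^ 2 * weilDecayConst (moll 0) := by
          refine mul_le_mul_of_nonneg_left ?_ (by positivity)
          calc ∫ t : ℝ, ‖deriv (deriv (moll 0)) t‖ ≤ weilL1 (deriv (deriv (moll 0))) := by
                unfold weilL1
                refine integral_mono_of_nonneg (Eventually.of_forall fun t => norm_nonneg _)
                  ((hcont.norm.mul (Real.continuous_exp.comp (continuous_abs.div_const _))).integrable_of_hasCompactSupport
                    (hcs.norm.mul_right)) (Eventually.of_forall fun t => ?_)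
                have : (1 : ℝ) ≤ Real.exp (|t| / 2) := Real.one_le_exp (by positivity)
                nlinarith [norm_nonneg (deriv (deriv (moll 0)) t)]
            _ ≤ weilDecayConst (moll 0) := by
                unfold weilDecayConst; linarith [weilL1_nonneg (moll 0)]
  unfold weilDecayConst at hL1 hL1'' ⊢
  have h1 : weilL1 (moll k) ≤ Real.exp (1 / 2) * a ^ 2 := by
    calc weilL1 (moll k) ≤ Real.exp (1 / 2) := hL1
      _ = Real.exp (1 / 2) * 1 := (mul_one _).symm
      _ ≤ Real.exp (1 / 2) * a ^ 2 := by gcongr; nlinarith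
  calc weilL1 (moll k) + weilL1 (deriv (deriv (moll k)))
      ≤ Real.exp (1 / 2) * a ^ 2 +
          Real.exp (1 / 2) * a ^ 2 * (weilL1 (moll 0) + weilL1 (deriv (deriv (moll 0)))) :=
        add_le_add h1 hL1''
    _ = Real.exp (1 / 2) * (1 + (weilL1 (moll 0) + weilL1 (deriv (deriv (moll 0))))) * a ^ 2 := by
        ring


/-- **Theorem E♭, kernel form modulo the seed, explicit in the mollifier index** [handoff/prove-1
ATTEMPT-11 §8; Bombieri 2000 §4]: as `weilGroundEnergy_le_of_summable_seed`, with
`D_{φ_k} ≤ e^{1/2}(1 + D_{φ_0})(k+1)²` substituted — so that, for a seed with `A ≍ poly(λ)e^{-2πλ²}`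
and `𝓜h(2) ≍ 1`, choosing `θ = e^{-w}`, `k + 1 ≍ λ^p` gives `ε(log λ + w + λ^{-p}) ≤ poly(λ)·e^{-4πλ²}`
with every factor explicit except the absolute constant `D_{φ_0}`. [cite: Bombieri2000Weil, §4] -/
theorem weilGroundEnergy_le_of_summable_seed_explicit (h : SchwartzMap ℝ ℂ)
    (heven : ∀ x, h (-x) = h x) (h0 : h 0 = 0) (hint : ∫ x : ℝ, h x = 0)
    (hsupp : ∀ x : ℝ, 1 < x → h x = 0) {lam : ℝ} (hlam : 2 ≤ lam) {A : ℝ} (hA : 0 ≤ A)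
    (hF : ∀ ξ : ℝ, lam ^ 2 ≤ ξ → ‖(𝓕 h : SchwartzMap ℝ ℂ) ξ‖ ≤ A * (ξ ^ 2)⁻¹)
    {M₂ : ℝ} (hM₂ : M₂ ≤ ‖mellin (fun x : ℝ => h x) 2‖)
    (hcg : 0 < Real.pi ^ 2 / 6 * M₂ * lam ^ 2 - 3 * A / lam ^ 2)
    {θ : ℝ} (hθ0 : 0 < θ) (hθ1 : θ < 1) (k : ℕ) :
    weilGroundEnergy (Real.log lam - Real.log θ + (bump k).rOut) ≤
      (3 * A / lam ^ 2 * (Real.exp (1 / 2) * (1 + weilDecayConst (moll 0)) * ((k : ℝ) + 1) ^ 2)) ^ 2 *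
        (∑' ρ : ZetaZeros.riemannZetaNontrivialZeros, weilZeroWeight (ρ : ℂ)) *
          (2 * (Real.log lam - Real.log θ + (bump k).rOut) *
            Real.exp (3 * (Real.log lam - Real.log θ + (bump k).rOut))) /
        ((Real.pi ^ 2 / 6 * M₂ * lam ^ 2 - 3 * A / lam ^ 2) * Real.exp (-(3 / 2 : ℝ))) ^ 2 := by
  have base := weilGroundEnergy_le_of_summable_seed h heven h0 hint hsupp hlam hA hF hM₂ hcg hθ0 hθ1 k
  refine base.trans ?_
  have hlam0 : 0 < lam := by linarith
  have hW0 : 0 ≤ ∑' ρ : ZetaZeros.riemannZetaNontrivialZeros, weilZeroWeight (ρ : ℂ) :=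
    tsum_weilZeroWeight_nonneg
  have hr : 0 < (bump k).rOut := (bump k).rOut_pos
  have ha : 0 < Real.log lam - Real.log θ + (bump k).rOut := by
    have := Real.log_nonneg (by linarith : (1 : ℝ) ≤ lam)
    have := Real.log_neg hθ0 hθ1
    linarith
  have hT0 : 0 ≤ 2 * (Real.log lam - Real.log θ + (bump k).rOut) *
      Real.exp (3 * (Real.log lam - Real.log θ + (bump k).rOut)) := by positivity
  have hden : 0 < ((Real.pi ^ 2 / 6 * M₂ * lam ^ 2 - 3 * A / lam ^ 2) * Real.exp (-(3 / 2 : ℝ))) ^ 2 := by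
    positivity
  have hDk : 3 * A / lam ^ 2 * weilDecayConst (moll k) ≤
      3 * A / lam ^ 2 * (Real.exp (1 / 2) * (1 + weilDecayConst (moll 0)) * ((k : ℝ) + 1) ^ 2) :=
    mul_le_mul_of_nonneg_left (weilDecayConst_moll_le k) (by positivity)
  have hDk0 : 0 ≤ 3 * A / lam ^ 2 * weilDecayConst (moll k) :=
    mul_nonneg (by positivity) (weilDecayConst_nonneg _)
  refine div_le_div_of_nonneg_right ?_ hden.le
  exact mul_le_mul_of_nonneg_right
    (mul_le_mul_of_nonneg_right (pow_le_pow_left₀ hDk0 hDk 2) hW0) hT0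

end Summit.RiemannHypothesis.RiemannHypothesis.Theorems.HandoffRouteE
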